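import Summits.QuantumFields.BalabanUV.Beta.D1BFx.PackedRoadRowsMass

/-!
# `BalabanUV.Beta.D1BFx.PackedRoadRowsMassFlat` — road «BF-x» for binder row D1, slot (K): **«17-M♭ INPUT SPLIT» — THE FAÇADE
# `PackedRoadRowsMass` WITH THE FIRST-JET MASS INPUTS SPLIT PER BLOCK: ff PER SLOT, mm BY THE SOCKET, fm∕mf AS PACKED ROWS (HYPOTHESES)**

HONEST DEPENDENCY (cell records, verbatim): «continuum YM on T⁴ ⇐ BetaPertH ∧ nine spine estimates (0/9 proved); BetaPertH ⇐ (D1) ∧ (D4) ∧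
CAP+tail; G-an2-4 gates asym, D1 and NE2/3/4.»  HONEST FRAMING (cell contract, verbatim): «discharging `BetaPertH` makes Bałaban's UV stability
UNCONDITIONAL — a real constructive-QFT result; it is NOT the continuum limit and NOT the Clay problem.»  THIS MODULE DISCHARGES NOTHING of the
wall: [folklore] plumbing over OUR typed objects — gan24-leaf-05's packed-column mass calculus (`PackedColumnJetMass.blk_vertexOfK ∕ mass_sum_wsum_colH_G₀_le`),
this lineage's `PackedRoadJetRows` block letters of the N-side stencil `SN` and the gen-25 façade `PackedRoadRowsMass` BY NAME.  No definition, no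
`def … : Prop`, no notation, nothing cited, 0 sorry.  0 root-level binders of row D1 discharged (hW ∕ hR-sockets ∕ hSX-socket ∕ D1Tel ∕ D1Rep — 0); (K) NOT
closed; NOT D1, NOT `BetaPertH`, NOT continuum, NOT Clay.

ABSOLUTE RULE (cell charter, verbatim): «No internally-minted statement may enter as a cited fact. Every hypothesis is either kernel-proved in
this package or a verbatim quotation of a PUBLISHED theorem with page reference. The manuscript(s) under audit are NOT citable for their own
disputed steps — they are the thing under adjudication; programme-internal (2001/route/tribunal) claims are never citable.»

WHY (unit `b2b-balaban-beta-d1-formalise-leaf-01`, gen 27; INTENT-4, journal; OWNER d1-p2 g22 W-2 ∕ ρ-g22-1 (b); an2 R-D1-g43-1 (M-a)(M-b) ∕ R-D1-g43-3).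
`PackedRoadRowsMass.jet_letters_mass` (17-M's input) displays ONE per-slot `u`-centred weighted block-mass letter `hSs hSm` of the literal's first stencils
`S (Lc^k) κ u` for ALL FOUR blocks `(j,k′)`, k-free.  At the literal of record's RAW first-order tables the fm∕mf per-slot sup is NOT k-free (this lineage's
exact counts N-1: the worst-slot V-sector mass grows linearly in `n`), so a head displaying those letters would be vacuous; the row ruled (M-b): ff per slot,
mm `= 0` by the structural socket, fm∕mf in PACKED form per coarse bond.  This file is that split, everything else byte-identical to 17-M's façade:
* §1 per-scale cores at `n = m+1`: `road_jet_mass_tt_le` — the ff block of the road's packed first jet `vertexOfK G₀^{bm}(r) n (SN m a S) ρ y` from the ff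
  PER-SLOT letter of `S` alone + (C1) (`≤ 4·C_{G₀}·(1+16∕κ′)⁴·(mS + mT)`); `road_jet_mass_flat_le` — all four blocks from: ff per slot, mm by
  `hSmm : blk (S κ u) ff = 0` (mass `0`), fm∕mf = HYPOTHESES in `PackedRoadRowsPow.road_jet_mass_at`'s OUTPUT shape on the RAW packed jet
  `blk (vertexOfK G₀^{bm}(r) n S ρ y) j k` (`j ≠ k`, `(n•y)`-centred, rate `σ`, `≤ mP j k`; weights `colH (G₀^{bm} r)` by `blk_vertexOfK` — the supplier's
  face), carried through `SN` by `blk_tf_SN ∕ blk_ft_SN` (a sign never changes a mass).  Displayed bound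
  `mV♭ j k := bif (j && k) then 4·C_{G₀}·(1+16∕κ′)⁴·(mS + mT) else bif (j || k) then mP j k else 0`.  `road_jet_mass_at_tt ∕ _at_flat`: any `[NeZero N]`.
* §2 `jet_letters_mass_flat` — 17-M's `jet_letters_mass` on the scales `Lc^k`, `k ≥ 1`, binders `{σS mS} hSs hSm` (ff only), `hSmm`, `{σP mP} hσVP hPs hPm`
  (rates `σV ≤ σS`, `σV ≤ σP` by `mass_rate_mono`); `jet_letters_mass_tt` — the ff block from `hSs hSm` + (C1) only.
* §3 `road_blk_rows_mass_flat` — PART 13∕14∕15's block lane (`CUblk … mV♭ …`) with the split inputs; `road_sand_rows_mass_tt` — the SANDWICH lane from the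
  ff per-slot letter + (C1) ALONE (17-M's `road_sand_rows_mass` read the `(tt)` instance only; here the idle fm∕mf∕mm letters are not even asked).
NOT HERE (honest): the same split of the PAIR letters `hBs hBm` of `table_letters_mass` (unchanged here); the letters themselves; the END; `TshotOf`.
-/

noncomputable section

open Finset
open scoped BigOperators
open Literature.MathematicalPhysics.QuantumFieldTheory.Balaban1983to89
open Literature.MathematicalPhysics.QuantumFieldTheory.Balaban1983to89.Beta
open B12Sec2to5 (l1 l1_nonneg)
open B5Hk163Strip (kappa163 kappa163_pos)
open B5Hk163Decay (MG163)
open B4TorusKernel (periodConst)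
open DecimatedMomentSummable (AbsMoment₂)
open ExpKernelCalculus (Site MKer BiLoc Zl)
open OneStepResolventKernel (Fib wsum)
open OneStepKernelFamily (KInvStep colH vertexOfK)
open AffineAveraging (box toSite)
open VectorTailsLoc (fam kfam)
open Summit.QuantumFields.BalabanUV.Beta.AxialDressingRooted (coDressKBmAt)
open Summit.QuantumFields.BalabanUV.Beta.D1BFx.PackedKernelSplit (blk)
open Summit.QuantumFields.BalabanUV.Beta.D1BFx.PackedSortedBridges (embFF)
open Summit.QuantumFields.BalabanUV.Beta.D1BFx.FrozenLegTails (nOf MOf hn1)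
open Summit.QuantumFields.BalabanUV.Beta.D1BFx.TorusWeightWordTwisted (tBw₁)
open Summit.QuantumFields.BalabanUV.Beta.D1BFx.PackedCoframePairLimit (cofPairInf)
open Summit.QuantumFields.BalabanUV.Beta.D1BFx.PackedNSideDictionary (SN)
open Summit.QuantumFields.BalabanUV.Beta.D1BFx.PackedNSideReadout (blk_tt_SN)
open Summit.QuantumFields.BalabanUV.Beta.D1BFx.PackedColumnJetMass (blk_vertexOfK mass_sum_wsum_colH_G₀_le)
open Summit.QuantumFields.BalabanUV.Beta.D1BFx.PackedRoadJetRows (blk_ft_SN blk_tf_SN blk_ff_SN mass_integrand_neg mass_add_le)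
open Summit.QuantumFields.BalabanUV.Beta.D1BFx.RestKernelSandwichSlot (RkSand CUsand)
open Summit.QuantumFields.BalabanUV.Beta.D1BFx.RestKernelBlockSlot (RkBlk CUblk)
open Summit.QuantumFields.BalabanUV.Beta.D1BFx.RestKernelSlotRowsOn (exists_END_rows_RkSand_pow exists_END_rows_RkBlk_pow)
open Summit.QuantumFields.BalabanUV.Beta.D1BFx.PackedRoadTableRows (road_tableRate_pos)
open Summit.QuantumFields.BalabanUV.Beta.D1BFx.PackedRoadRestFamily (Vroad Wroad)
open Summit.QuantumFields.BalabanUV.Beta.D1BFx.PackedRoadRowsPow (rate_window Vroad_of_neZero)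
open Summit.QuantumFields.BalabanUV.Beta.D1BFx.PackedRoadRowsMass (mass_rate_mono table_letters_mass)

namespace Summit.QuantumFields.BalabanUV.Beta.D1BFx.PackedRoadRowsMassFlat

/-! ## §1 Per-scale cores: the ff block from the ff per-slot letter; all four blocks from the split inputs -/

section Core

variable (m : ℕ) {a : ℝ} {r : Fin (3 + 1) → ℕ} (hr : r ∈ box (3 + 1) (m + 1)) {S : Fin 4 → (Fin 4 → ℤ) → MKer 4 (Fib 3)}
  {σ : ℝ} (hσ0 : 0 ≤ σ) (hσ : σ ≤ kappa163 4 / 4 / (16 * ((m + 1 : ℕ) : ℝ))) {mS mT : ℝ}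
include hr hσ0 hσ

/-- [folklore] **THE ff BLOCK OF THE ROAD's PACKED FIRST JET FROM THE ff PER-SLOT LETTER ALONE** (`n = m+1`, rate `0 ≤ σ ≤ κ′∕(16n)`): if the ff block of
every `S κ u` has `u`-centred `σ`-weighted mass `≤ mS` and the co-frame kernels `tBw₁ n a κ u` have `≤ mT`, the ff block of `vertexOfK G₀^{bm}(r) n (SN m a S) ρ y`
has summable `n•y`-centred `σ`-weighted mass `≤ 4·C_{G₀}·(1+16∕κ′)⁴·(mS + mT)` (`blk_tt_SN`, `mass_add_le`, gan24-leaf-05's `mass_sum_wsum_colH_G₀_le`). -/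
theorem road_jet_mass_tt_le
    (hSs : ∀ κ u, Summable fun p : Site 4 × Site 4 =>
      ∑ g, ∑ f, |blk (S κ u) true true p.1 p.2 g f| * Real.exp (σ * (l1 (p.1 - u) + l1 (p.2 - u))))
    (hSm : ∀ κ u, ∑' p : Site 4 × Site 4,
      ∑ g, ∑ f, |blk (S κ u) true true p.1 p.2 g f| * Real.exp (σ * (l1 (p.1 - u) + l1 (p.2 - u))) ≤ mS)
    (hTs : ∀ κ u, Summable fun p : Site 4 × Site 4 =>
      ∑ g, ∑ f, |tBw₁ (m + 1) a κ u p.1 p.2 g f| * Real.exp (σ * (l1 (p.1 - u) + l1 (p.2 - u))))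
    (hTm : ∀ κ u, ∑' p : Site 4 × Site 4,
      ∑ g, ∑ f, |tBw₁ (m + 1) a κ u p.1 p.2 g f| * Real.exp (σ * (l1 (p.1 - u) + l1 (p.2 - u))) ≤ mT)
    (ρ : Fin (3 + 1)) (y : Fin (3 + 1) → ℤ) :
    (Summable fun p : Site 4 × Site 4 => ∑ g, ∑ f,
        |blk (vertexOfK (coDressKBmAt (toSite r) (m + 1) (KInvStep (d := 3) (m + 1) 0)) (m + 1) (SN m a S) ρ y) true true p.1 p.2 g f|
          * Real.exp (σ * (l1 (p.1 - ((m + 1 : ℕ) : ℤ) • y) + l1 (p.2 - ((m + 1 : ℕ) : ℤ) • y)))) ∧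
      ∑' p : Site 4 × Site 4, ∑ g, ∑ f,
          |blk (vertexOfK (coDressKBmAt (toSite r) (m + 1) (KInvStep (d := 3) (m + 1) 0)) (m + 1) (SN m a S) ρ y) true true p.1 p.2 g f|
            * Real.exp (σ * (l1 (p.1 - ((m + 1 : ℕ) : ℤ) • y) + l1 (p.2 - ((m + 1 : ℕ) : ℤ) • y)))
        ≤ 4 * ((MG163 4 * periodConst (kappa163 4) 3) * (1 + 8 * (1 + Real.exp (kappa163 4 / 4))) * Real.exp (kappa163 4 / 4))
            * (1 + 16 / (kappa163 4 / 4)) ^ 4 * (mS + mT) := by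
  have hT : ∀ (κ : Fin 4) (u : Fin 4 → ℤ),
      (Summable fun p : Site 4 × Site 4 =>
        ∑ g, ∑ f, |blk (SN m a S κ u) true true p.1 p.2 g f| * Real.exp (σ * (l1 (p.1 - u) + l1 (p.2 - u)))) ∧
      ∑' p : Site 4 × Site 4,
        ∑ g, ∑ f, |blk (SN m a S κ u) true true p.1 p.2 g f| * Real.exp (σ * (l1 (p.1 - u) + l1 (p.2 - u))) ≤ mS + mT := fun κ u => by
    rw [blk_tt_SN]
    exact mass_add_le (fun _ => (Real.exp_pos _).le) (hSs κ u) (hSm κ u) (hTs κ u) (hTm κ u)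
  rw [blk_vertexOfK]
  exact mass_sum_wsum_colH_G₀_le m hr (T := fun κ u => blk (SN m a S κ u) true true) hσ0 hσ
    (fun κ u => (hT κ u).1) (fun κ u => (hT κ u).2) ρ y

/-- [folklore] **ALL FOUR BLOCKS OF THE ROAD's PACKED FIRST JET FROM THE SPLIT INPUTS** (`n = m+1`, rate `0 ≤ σ ≤ κ′∕(16n)`): ff per slot (`hSs hSm`), the
co-frame letter (`hTs hTm`), mm by the socket `hSmm : blk (S κ u) ff = 0`, and fm∕mf as PACKED rows — the `n•y`-centred `σ`-weighted masses of the blocks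
`j ≠ k` of the RAW packed jet `vertexOfK G₀^{bm}(r) n S ρ y` (`≤ mP j k`): every block of `vertexOfK G₀^{bm}(r) n (SN m a S) ρ y` has summable mass
`≤ mV♭ j k := bif (j && k) then 4·C_{G₀}·(1+16∕κ′)⁴·(mS + mT) else bif (j || k) then mP j k else 0` (`blk_ft_SN`: mf block unchanged; `blk_tf_SN`: fm block
negated — same mass; `blk_ff_SN` + `hSmm`: mm block `0`). -/
theorem road_jet_mass_flat_le
    (hSs : ∀ κ u, Summable fun p : Site 4 × Site 4 =>
      ∑ g, ∑ f, |blk (S κ u) true true p.1 p.2 g f| * Real.exp (σ * (l1 (p.1 - u) + l1 (p.2 - u))))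
    (hSm : ∀ κ u, ∑' p : Site 4 × Site 4,
      ∑ g, ∑ f, |blk (S κ u) true true p.1 p.2 g f| * Real.exp (σ * (l1 (p.1 - u) + l1 (p.2 - u))) ≤ mS)
    (hSmm : ∀ κ u, blk (S κ u) false false = 0)
    (hTs : ∀ κ u, Summable fun p : Site 4 × Site 4 =>
      ∑ g, ∑ f, |tBw₁ (m + 1) a κ u p.1 p.2 g f| * Real.exp (σ * (l1 (p.1 - u) + l1 (p.2 - u))))
    (hTm : ∀ κ u, ∑' p : Site 4 × Site 4,
      ∑ g, ∑ f, |tBw₁ (m + 1) a κ u p.1 p.2 g f| * Real.exp (σ * (l1 (p.1 - u) + l1 (p.2 - u))) ≤ mT)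
    {mP : Bool → Bool → ℝ}
    (hPs : ∀ (ρ : Fin (3 + 1)) (y : Fin (3 + 1) → ℤ) (j k : Bool), j ≠ k → Summable fun p : Site 4 × Site 4 => ∑ g, ∑ f,
      |blk (vertexOfK (coDressKBmAt (toSite r) (m + 1) (KInvStep (d := 3) (m + 1) 0)) (m + 1) S ρ y) j k p.1 p.2 g f|
        * Real.exp (σ * (l1 (p.1 - ((m + 1 : ℕ) : ℤ) • y) + l1 (p.2 - ((m + 1 : ℕ) : ℤ) • y))))
    (hPm : ∀ (ρ : Fin (3 + 1)) (y : Fin (3 + 1) → ℤ) (j k : Bool), j ≠ k → ∑' p : Site 4 × Site 4, ∑ g, ∑ f,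
      |blk (vertexOfK (coDressKBmAt (toSite r) (m + 1) (KInvStep (d := 3) (m + 1) 0)) (m + 1) S ρ y) j k p.1 p.2 g f|
        * Real.exp (σ * (l1 (p.1 - ((m + 1 : ℕ) : ℤ) • y) + l1 (p.2 - ((m + 1 : ℕ) : ℤ) • y))) ≤ mP j k)
    (ρ : Fin (3 + 1)) (y : Fin (3 + 1) → ℤ) (j k : Bool) :
    (Summable fun p : Site 4 × Site 4 => ∑ g, ∑ f,
        |blk (vertexOfK (coDressKBmAt (toSite r) (m + 1) (KInvStep (d := 3) (m + 1) 0)) (m + 1) (SN m a S) ρ y) j k p.1 p.2 g f|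
          * Real.exp (σ * (l1 (p.1 - ((m + 1 : ℕ) : ℤ) • y) + l1 (p.2 - ((m + 1 : ℕ) : ℤ) • y)))) ∧
      ∑' p : Site 4 × Site 4, ∑ g, ∑ f,
          |blk (vertexOfK (coDressKBmAt (toSite r) (m + 1) (KInvStep (d := 3) (m + 1) 0)) (m + 1) (SN m a S) ρ y) j k p.1 p.2 g f|
            * Real.exp (σ * (l1 (p.1 - ((m + 1 : ℕ) : ℤ) • y) + l1 (p.2 - ((m + 1 : ℕ) : ℤ) • y)))
        ≤ (bif (j && k) then 4 * ((MG163 4 * periodConst (kappa163 4) 3) * (1 + 8 * (1 + Real.exp (kappa163 4 / 4))) * Real.exp (kappa163 4 / 4))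
            * (1 + 16 / (kappa163 4 / 4)) ^ 4 * (mS + mT) else bif (j || k) then mP j k else 0) := by
  cases j <;> cases k
  · -- the mm block: `0` by the socket
    have h0 : blk (vertexOfK (coDressKBmAt (toSite r) (m + 1) (KInvStep (d := 3) (m + 1) 0)) (m + 1) (SN m a S) ρ y) false false = 0 := by
      rw [blk_vertexOfK]
      refine Finset.sum_eq_zero fun κ _ => ?_
      funext x z g f
      simp only [wsum, blk_ff_SN, hSmm, neg_zero, Pi.zero_apply, mul_zero, tsum_zero]
    rw [h0]
    simp only [Pi.zero_apply, abs_zero, zero_mul, Finset.sum_const_zero, tsum_zero, Bool.false_and, Bool.false_or, cond_false]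
    exact ⟨summable_zero, le_rfl⟩
  · -- the mf block: unchanged under `SN`
    have h1 : blk (vertexOfK (coDressKBmAt (toSite r) (m + 1) (KInvStep (d := 3) (m + 1) 0)) (m + 1) (SN m a S) ρ y) false true
        = blk (vertexOfK (coDressKBmAt (toSite r) (m + 1) (KInvStep (d := 3) (m + 1) 0)) (m + 1) S ρ y) false true := by
      rw [blk_vertexOfK, blk_vertexOfK]
      refine Finset.sum_congr rfl fun κ _ => ?_
      funext x z g f
      simp only [wsum, blk_ft_SN]
    rw [h1]
    simp only [Bool.false_and, Bool.false_or, cond_true, cond_false]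
    exact ⟨hPs ρ y false true (by decide), hPm ρ y false true (by decide)⟩
  · -- the fm block: negated under `SN` — same mass
    have h1 : blk (vertexOfK (coDressKBmAt (toSite r) (m + 1) (KInvStep (d := 3) (m + 1) 0)) (m + 1) (SN m a S) ρ y) true false
        = -blk (vertexOfK (coDressKBmAt (toSite r) (m + 1) (KInvStep (d := 3) (m + 1) 0)) (m + 1) S ρ y) true false := by
      rw [blk_vertexOfK, blk_vertexOfK, ← Finset.sum_neg_distrib]
      refine Finset.sum_congr rfl fun κ _ => ?_
      funext x z g f
      simp only [wsum, blk_tf_SN, Pi.neg_apply, mul_neg, tsum_neg]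
    rw [h1, mass_integrand_neg]
    simp only [Bool.true_and, Bool.true_or, cond_true, cond_false]
    exact ⟨hPs ρ y true false (by decide), hPm ρ y true false (by decide)⟩
  · -- the ff block
    simp only [Bool.true_and, cond_true]
    exact road_jet_mass_tt_le m hr hσ0 hσ hSs hSm hTs hTm ρ y

end Core

/-! ## §1b The same at any block size `[NeZero N]` -/

section AtN

variable (N : ℕ) [NeZero N] {a : ℝ} {r : Fin (3 + 1) → ℕ} (hr : r ∈ box (3 + 1) N) {S : Fin 4 → (Fin 4 → ℤ) → MKer 4 (Fib 3)}
  {σ : ℝ} (hσ0 : 0 ≤ σ) (hσ : σ ≤ kappa163 4 / 4 / (16 * ((N : ℕ) : ℝ))) {mS mT : ℝ}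
include hr hσ0 hσ

/-- [folklore] **`road_jet_mass_tt_le` AT ANY BLOCK SIZE `[NeZero N]`** (`N = (N−1)+1`, one `obtain`). -/
theorem road_jet_mass_at_tt
    (hSs : ∀ κ u, Summable fun p : Site 4 × Site 4 =>
      ∑ g, ∑ f, |blk (S κ u) true true p.1 p.2 g f| * Real.exp (σ * (l1 (p.1 - u) + l1 (p.2 - u))))
    (hSm : ∀ κ u, ∑' p : Site 4 × Site 4,
      ∑ g, ∑ f, |blk (S κ u) true true p.1 p.2 g f| * Real.exp (σ * (l1 (p.1 - u) + l1 (p.2 - u))) ≤ mS)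
    (hTs : ∀ κ u, Summable fun p : Site 4 × Site 4 =>
      ∑ g, ∑ f, |tBw₁ N a κ u p.1 p.2 g f| * Real.exp (σ * (l1 (p.1 - u) + l1 (p.2 - u))))
    (hTm : ∀ κ u, ∑' p : Site 4 × Site 4,
      ∑ g, ∑ f, |tBw₁ N a κ u p.1 p.2 g f| * Real.exp (σ * (l1 (p.1 - u) + l1 (p.2 - u))) ≤ mT)
    (ρ : Fin (3 + 1)) (y : Fin (3 + 1) → ℤ) :
    (Summable fun p : Site 4 × Site 4 => ∑ g, ∑ f,
        |blk (vertexOfK (coDressKBmAt (toSite r) N (KInvStep (d := 3) N 0)) N (SN (N - 1) a S) ρ y) true true p.1 p.2 g f|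
          * Real.exp (σ * (l1 (p.1 - ((N : ℕ) : ℤ) • y) + l1 (p.2 - ((N : ℕ) : ℤ) • y)))) ∧
      ∑' p : Site 4 × Site 4, ∑ g, ∑ f,
          |blk (vertexOfK (coDressKBmAt (toSite r) N (KInvStep (d := 3) N 0)) N (SN (N - 1) a S) ρ y) true true p.1 p.2 g f|
            * Real.exp (σ * (l1 (p.1 - ((N : ℕ) : ℤ) • y) + l1 (p.2 - ((N : ℕ) : ℤ) • y)))
        ≤ 4 * ((MG163 4 * periodConst (kappa163 4) 3) * (1 + 8 * (1 + Real.exp (kappa163 4 / 4))) * Real.exp (kappa163 4 / 4))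
            * (1 + 16 / (kappa163 4 / 4)) ^ 4 * (mS + mT) := by
  obtain ⟨M, rfl⟩ : ∃ M, N = M + 1 := ⟨N - 1, (Nat.succ_pred_eq_of_ne_zero (NeZero.ne N)).symm⟩
  exact road_jet_mass_tt_le M hr hσ0 hσ hSs hSm hTs hTm ρ y

/-- [folklore] **`road_jet_mass_flat_le` AT ANY BLOCK SIZE `[NeZero N]`** — `PackedRoadRowsPow.road_jet_mass_at` with the split inputs. -/
theorem road_jet_mass_at_flat
    (hSs : ∀ κ u, Summable fun p : Site 4 × Site 4 =>
      ∑ g, ∑ f, |blk (S κ u) true true p.1 p.2 g f| * Real.exp (σ * (l1 (p.1 - u) + l1 (p.2 - u))))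
    (hSm : ∀ κ u, ∑' p : Site 4 × Site 4,
      ∑ g, ∑ f, |blk (S κ u) true true p.1 p.2 g f| * Real.exp (σ * (l1 (p.1 - u) + l1 (p.2 - u))) ≤ mS)
    (hSmm : ∀ κ u, blk (S κ u) false false = 0)
    (hTs : ∀ κ u, Summable fun p : Site 4 × Site 4 =>
      ∑ g, ∑ f, |tBw₁ N a κ u p.1 p.2 g f| * Real.exp (σ * (l1 (p.1 - u) + l1 (p.2 - u))))
    (hTm : ∀ κ u, ∑' p : Site 4 × Site 4,
      ∑ g, ∑ f, |tBw₁ N a κ u p.1 p.2 g f| * Real.exp (σ * (l1 (p.1 - u) + l1 (p.2 - u))) ≤ mT)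
    {mP : Bool → Bool → ℝ}
    (hPs : ∀ (ρ : Fin (3 + 1)) (y : Fin (3 + 1) → ℤ) (j k : Bool), j ≠ k → Summable fun p : Site 4 × Site 4 => ∑ g, ∑ f,
      |blk (vertexOfK (coDressKBmAt (toSite r) N (KInvStep (d := 3) N 0)) N S ρ y) j k p.1 p.2 g f|
        * Real.exp (σ * (l1 (p.1 - ((N : ℕ) : ℤ) • y) + l1 (p.2 - ((N : ℕ) : ℤ) • y))))
    (hPm : ∀ (ρ : Fin (3 + 1)) (y : Fin (3 + 1) → ℤ) (j k : Bool), j ≠ k → ∑' p : Site 4 × Site 4, ∑ g, ∑ f,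
      |blk (vertexOfK (coDressKBmAt (toSite r) N (KInvStep (d := 3) N 0)) N S ρ y) j k p.1 p.2 g f|
        * Real.exp (σ * (l1 (p.1 - ((N : ℕ) : ℤ) • y) + l1 (p.2 - ((N : ℕ) : ℤ) • y))) ≤ mP j k)
    (ρ : Fin (3 + 1)) (y : Fin (3 + 1) → ℤ) (j k : Bool) :
    (Summable fun p : Site 4 × Site 4 => ∑ g, ∑ f,
        |blk (vertexOfK (coDressKBmAt (toSite r) N (KInvStep (d := 3) N 0)) N (SN (N - 1) a S) ρ y) j k p.1 p.2 g f|
          * Real.exp (σ * (l1 (p.1 - ((N : ℕ) : ℤ) • y) + l1 (p.2 - ((N : ℕ) : ℤ) • y)))) ∧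
      ∑' p : Site 4 × Site 4, ∑ g, ∑ f,
          |blk (vertexOfK (coDressKBmAt (toSite r) N (KInvStep (d := 3) N 0)) N (SN (N - 1) a S) ρ y) j k p.1 p.2 g f|
            * Real.exp (σ * (l1 (p.1 - ((N : ℕ) : ℤ) • y) + l1 (p.2 - ((N : ℕ) : ℤ) • y)))
        ≤ (bif (j && k) then 4 * ((MG163 4 * periodConst (kappa163 4) 3) * (1 + 8 * (1 + Real.exp (kappa163 4 / 4))) * Real.exp (kappa163 4 / 4))
            * (1 + 16 / (kappa163 4 / 4)) ^ 4 * (mS + mT) else bif (j || k) then mP j k else 0) := by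
  obtain ⟨M, rfl⟩ : ∃ M, N = M + 1 := ⟨N - 1, (Nat.succ_pred_eq_of_ne_zero (NeZero.ne N)).symm⟩
  exact road_jet_mass_flat_le M hr hσ0 hσ hSs hSm hSmm hTs hTm hPs hPm ρ y j k

end AtN

/-! ## §2 The lane letters at the block sizes `Lc^k` from the SPLIT mass inputs -/

section Letters

variable {Lc : ℕ} [NeZero Lc] {a : ℝ} {r : ℕ → Fin (3 + 1) → ℕ} {S : ℕ → Fin 4 → (Fin 4 → ℤ) → MKer 4 (Fib 3)}

/-- [folklore] **THE ff BLOCK LETTER OF `Vroad a r S (Lc^k)`, `k ≥ 1`, FROM THE ff PER-SLOT LETTER + (C1) ON THE SCALES**: roots `hr`, the ff per-slot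
letter at rate `σS∕Lc^k` (`≤ mS`, k-free), one rate `0 ≤ σV ≤ κ′∕16`, `σV ≤ σS`, (C1) at rate `σV∕Lc^k` (`≤ mT`): the ff block of `Vroad a r S (Lc^k) ρ y` has
summable `(Lc^k)•y`-centred `σV∕Lc^k`-weighted mass `≤ 4·C_{G₀}·(1+16∕κ′)⁴·(mS + mT)`.  (The SANDWICH lane's whole first-jet input.) -/
theorem jet_letters_mass_tt (hr : ∀ m : ℕ, r (m + 1) ∈ box (3 + 1) (m + 1)) {σS mS : ℝ}
    (hSs : ∀ (k : ℕ), 1 ≤ k → ∀ (κ : Fin 4) (u : Fin 4 → ℤ), Summable fun p : Site 4 × Site 4 =>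
      ∑ g, ∑ f, |blk (S (Lc ^ k) κ u) true true p.1 p.2 g f| * Real.exp (σS / ((Lc ^ k : ℕ) : ℝ) * (l1 (p.1 - u) + l1 (p.2 - u))))
    (hSm : ∀ (k : ℕ), 1 ≤ k → ∀ (κ : Fin 4) (u : Fin 4 → ℤ), ∑' p : Site 4 × Site 4,
      ∑ g, ∑ f, |blk (S (Lc ^ k) κ u) true true p.1 p.2 g f| * Real.exp (σS / ((Lc ^ k : ℕ) : ℝ) * (l1 (p.1 - u) + l1 (p.2 - u))) ≤ mS)
    {σV : ℝ} (hσV0 : 0 ≤ σV) (hσVκ : σV ≤ kappa163 4 / 4 / 16) (hσVσ : σV ≤ σS) {mT : ℝ}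
    (hTs : ∀ (k : ℕ), 1 ≤ k → ∀ (κ : Fin 4) (u : Fin 4 → ℤ), Summable fun p : Site 4 × Site 4 =>
      ∑ g, ∑ f, |tBw₁ (Lc ^ k) a κ u p.1 p.2 g f| * Real.exp (σV / ((Lc ^ k : ℕ) : ℝ) * (l1 (p.1 - u) + l1 (p.2 - u))))
    (hTm : ∀ (k : ℕ), 1 ≤ k → ∀ (κ : Fin 4) (u : Fin 4 → ℤ), ∑' p : Site 4 × Site 4,
      ∑ g, ∑ f, |tBw₁ (Lc ^ k) a κ u p.1 p.2 g f| * Real.exp (σV / ((Lc ^ k : ℕ) : ℝ) * (l1 (p.1 - u) + l1 (p.2 - u))) ≤ mT) :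
    ∀ (k : ℕ), 1 ≤ k → ∀ (ρ : Fin 4) (y : Site 4),
      (Summable fun p : Site 4 × Site 4 => ∑ g, ∑ f, |blk (Vroad a r S (Lc ^ k) ρ y) true true p.1 p.2 g f|
        * Real.exp (σV / ((Lc ^ k : ℕ) : ℝ) * (l1 (p.1 - ((Lc ^ k : ℕ) : ℤ) • y) + l1 (p.2 - ((Lc ^ k : ℕ) : ℤ) • y)))) ∧
      ∑' p : Site 4 × Site 4, ∑ g, ∑ f, |blk (Vroad a r S (Lc ^ k) ρ y) true true p.1 p.2 g f|
        * Real.exp (σV / ((Lc ^ k : ℕ) : ℝ) * (l1 (p.1 - ((Lc ^ k : ℕ) : ℤ) • y) + l1 (p.2 - ((Lc ^ k : ℕ) : ℤ) • y)))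
      ≤ 4 * ((MG163 4 * periodConst (kappa163 4) 3) * (1 + 8 * (1 + Real.exp (kappa163 4 / 4))) * Real.exp (kappa163 4 / 4))
            * (1 + 16 / (kappa163 4 / 4)) ^ 4 * (mS + mT) := by
  intro k hk ρ y
  have hn0 : (0 : ℝ) < ((Lc ^ k : ℕ) : ℝ) := by
    exact_mod_cast Nat.pos_of_ne_zero (pow_ne_zero k (NeZero.ne Lc))
  have hrk : r (Lc ^ k) ∈ box (3 + 1) (Lc ^ k) := by
    have h := hr (Lc ^ k - 1)
    rwa [Nat.sub_add_cancel (Nat.one_le_pow _ _ (Nat.pos_of_ne_zero (NeZero.ne Lc)))] at h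
  have hrate : σV / ((Lc ^ k : ℕ) : ℝ) ≤ σS / ((Lc ^ k : ℕ) : ℝ) := div_le_div_of_nonneg_right hσVσ hn0.le
  have hlit : ∀ (κ : Fin 4) (u : Fin 4 → ℤ),
      (Summable fun p : Site 4 × Site 4 => ∑ g, ∑ f, |blk (S (Lc ^ k) κ u) true true p.1 p.2 g f|
        * Real.exp (σV / ((Lc ^ k : ℕ) : ℝ) * (l1 (p.1 - u) + l1 (p.2 - u)))) ∧
      ∑' p : Site 4 × Site 4, ∑ g, ∑ f, |blk (S (Lc ^ k) κ u) true true p.1 p.2 g f|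
        * Real.exp (σV / ((Lc ^ k : ℕ) : ℝ) * (l1 (p.1 - u) + l1 (p.2 - u))) ≤ mS := fun κ u =>
    mass_rate_mono hrate (hSs k hk κ u) (hSm k hk κ u)
  rw [Vroad_of_neZero]
  exact road_jet_mass_at_tt (Lc ^ k) hrk (S := S (Lc ^ k)) (rate_window hσV0 hσVκ (Lc ^ k)).1 (rate_window hσV0 hσVκ (Lc ^ k)).2
    (fun κ u => (hlit κ u).1) (fun κ u => (hlit κ u).2) (hTs k hk) (hTm k hk) ρ y

/-- [folklore] **THE FIRST-JET BLOCK LETTERS OF `Vroad a r S (Lc^k)`, `k ≥ 1`, FROM THE SPLIT INPUTS ON THE SCALES** — 17-M's `jet_letters_mass` with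
`{σS mS} hSs hSm` (ALL blocks) REPLACED BY: the ff per-slot letter `{σS mS} hSs hSm` (rate `σS∕Lc^k`, `≤ mS`), the mm socket `hSmm`, and the PACKED fm∕mf rows
`{σP mP} hPs hPm` — the `(Lc^k)•y`-centred `σP∕Lc^k`-weighted masses of the blocks `j ≠ k′` of the RAW packed jet `vertexOfK G₀^{bm}(r (Lc^k)) (Lc^k) (S (Lc^k)) ρ y`
(`≤ mP j k′`, k-free); rates `σV ≤ σS`, `σV ≤ σP`; (C1) `hTs hTm` unchanged.  Bound `mV♭ j k′` of §1. -/
theorem jet_letters_mass_flat (hr : ∀ m : ℕ, r (m + 1) ∈ box (3 + 1) (m + 1)) {σS mS : ℝ}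
    (hSs : ∀ (k : ℕ), 1 ≤ k → ∀ (κ : Fin 4) (u : Fin 4 → ℤ), Summable fun p : Site 4 × Site 4 =>
      ∑ g, ∑ f, |blk (S (Lc ^ k) κ u) true true p.1 p.2 g f| * Real.exp (σS / ((Lc ^ k : ℕ) : ℝ) * (l1 (p.1 - u) + l1 (p.2 - u))))
    (hSm : ∀ (k : ℕ), 1 ≤ k → ∀ (κ : Fin 4) (u : Fin 4 → ℤ), ∑' p : Site 4 × Site 4,
      ∑ g, ∑ f, |blk (S (Lc ^ k) κ u) true true p.1 p.2 g f| * Real.exp (σS / ((Lc ^ k : ℕ) : ℝ) * (l1 (p.1 - u) + l1 (p.2 - u))) ≤ mS)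
    (hSmm : ∀ (k : ℕ), 1 ≤ k → ∀ (κ : Fin 4) (u : Fin 4 → ℤ), blk (S (Lc ^ k) κ u) false false = 0)
    {σV : ℝ} (hσV0 : 0 ≤ σV) (hσVκ : σV ≤ kappa163 4 / 4 / 16) (hσVσ : σV ≤ σS) {mT : ℝ}
    (hTs : ∀ (k : ℕ), 1 ≤ k → ∀ (κ : Fin 4) (u : Fin 4 → ℤ), Summable fun p : Site 4 × Site 4 =>
      ∑ g, ∑ f, |tBw₁ (Lc ^ k) a κ u p.1 p.2 g f| * Real.exp (σV / ((Lc ^ k : ℕ) : ℝ) * (l1 (p.1 - u) + l1 (p.2 - u))))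
    (hTm : ∀ (k : ℕ), 1 ≤ k → ∀ (κ : Fin 4) (u : Fin 4 → ℤ), ∑' p : Site 4 × Site 4,
      ∑ g, ∑ f, |tBw₁ (Lc ^ k) a κ u p.1 p.2 g f| * Real.exp (σV / ((Lc ^ k : ℕ) : ℝ) * (l1 (p.1 - u) + l1 (p.2 - u))) ≤ mT)
    {σP : ℝ} (hσVP : σV ≤ σP) {mP : Bool → Bool → ℝ}
    (hPs : ∀ (k : ℕ), 1 ≤ k → ∀ (ρ : Fin 4) (y : Site 4) (j k' : Bool), j ≠ k' → Summable fun p : Site 4 × Site 4 => ∑ g, ∑ f,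
      |blk (vertexOfK (coDressKBmAt (toSite (r (Lc ^ k))) (Lc ^ k) (KInvStep (d := 3) (Lc ^ k) 0)) (Lc ^ k) (S (Lc ^ k)) ρ y) j k' p.1 p.2 g f|
        * Real.exp (σP / ((Lc ^ k : ℕ) : ℝ) * (l1 (p.1 - ((Lc ^ k : ℕ) : ℤ) • y) + l1 (p.2 - ((Lc ^ k : ℕ) : ℤ) • y))))
    (hPm : ∀ (k : ℕ), 1 ≤ k → ∀ (ρ : Fin 4) (y : Site 4) (j k' : Bool), j ≠ k' → ∑' p : Site 4 × Site 4, ∑ g, ∑ f,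
      |blk (vertexOfK (coDressKBmAt (toSite (r (Lc ^ k))) (Lc ^ k) (KInvStep (d := 3) (Lc ^ k) 0)) (Lc ^ k) (S (Lc ^ k)) ρ y) j k' p.1 p.2 g f|
        * Real.exp (σP / ((Lc ^ k : ℕ) : ℝ) * (l1 (p.1 - ((Lc ^ k : ℕ) : ℤ) • y) + l1 (p.2 - ((Lc ^ k : ℕ) : ℤ) • y))) ≤ mP j k') :
    ∀ (k : ℕ), 1 ≤ k → ∀ (ρ : Fin 4) (y : Site 4) (j k' : Bool),
      (Summable fun p : Site 4 × Site 4 => ∑ g, ∑ f, |blk (Vroad a r S (Lc ^ k) ρ y) j k' p.1 p.2 g f|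
        * Real.exp (σV / ((Lc ^ k : ℕ) : ℝ) * (l1 (p.1 - ((Lc ^ k : ℕ) : ℤ) • y) + l1 (p.2 - ((Lc ^ k : ℕ) : ℤ) • y)))) ∧
      ∑' p : Site 4 × Site 4, ∑ g, ∑ f, |blk (Vroad a r S (Lc ^ k) ρ y) j k' p.1 p.2 g f|
        * Real.exp (σV / ((Lc ^ k : ℕ) : ℝ) * (l1 (p.1 - ((Lc ^ k : ℕ) : ℤ) • y) + l1 (p.2 - ((Lc ^ k : ℕ) : ℤ) • y)))
      ≤ (bif (j && k') then 4 * ((MG163 4 * periodConst (kappa163 4) 3) * (1 + 8 * (1 + Real.exp (kappa163 4 / 4))) * Real.exp (kappa163 4 / 4))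
            * (1 + 16 / (kappa163 4 / 4)) ^ 4 * (mS + mT) else bif (j || k') then mP j k' else 0) := by
  intro k hk ρ y j k'
  have hn0 : (0 : ℝ) < ((Lc ^ k : ℕ) : ℝ) := by
    exact_mod_cast Nat.pos_of_ne_zero (pow_ne_zero k (NeZero.ne Lc))
  have hrk : r (Lc ^ k) ∈ box (3 + 1) (Lc ^ k) := by
    have h := hr (Lc ^ k - 1)
    rwa [Nat.sub_add_cancel (Nat.one_le_pow _ _ (Nat.pos_of_ne_zero (NeZero.ne Lc)))] at h
  -- the ff per-slot letter and the packed rows at the smaller rate `σV∕n`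
  have hrate : σV / ((Lc ^ k : ℕ) : ℝ) ≤ σS / ((Lc ^ k : ℕ) : ℝ) := div_le_div_of_nonneg_right hσVσ hn0.le
  have hrateP : σV / ((Lc ^ k : ℕ) : ℝ) ≤ σP / ((Lc ^ k : ℕ) : ℝ) := div_le_div_of_nonneg_right hσVP hn0.le
  have hlit : ∀ (κ : Fin 4) (u : Fin 4 → ℤ),
      (Summable fun p : Site 4 × Site 4 => ∑ g, ∑ f, |blk (S (Lc ^ k) κ u) true true p.1 p.2 g f|
        * Real.exp (σV / ((Lc ^ k : ℕ) : ℝ) * (l1 (p.1 - u) + l1 (p.2 - u)))) ∧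
      ∑' p : Site 4 × Site 4, ∑ g, ∑ f, |blk (S (Lc ^ k) κ u) true true p.1 p.2 g f|
        * Real.exp (σV / ((Lc ^ k : ℕ) : ℝ) * (l1 (p.1 - u) + l1 (p.2 - u))) ≤ mS := fun κ u =>
    mass_rate_mono hrate (hSs k hk κ u) (hSm k hk κ u)
  have hpk : ∀ (ρ : Fin 4) (y : Site 4) (j k' : Bool), j ≠ k' →
      (Summable fun p : Site 4 × Site 4 => ∑ g, ∑ f,
        |blk (vertexOfK (coDressKBmAt (toSite (r (Lc ^ k))) (Lc ^ k) (KInvStep (d := 3) (Lc ^ k) 0)) (Lc ^ k) (S (Lc ^ k)) ρ y) j k' p.1 p.2 g f|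
          * Real.exp (σV / ((Lc ^ k : ℕ) : ℝ) * (l1 (p.1 - ((Lc ^ k : ℕ) : ℤ) • y) + l1 (p.2 - ((Lc ^ k : ℕ) : ℤ) • y)))) ∧
      ∑' p : Site 4 × Site 4, ∑ g, ∑ f,
        |blk (vertexOfK (coDressKBmAt (toSite (r (Lc ^ k))) (Lc ^ k) (KInvStep (d := 3) (Lc ^ k) 0)) (Lc ^ k) (S (Lc ^ k)) ρ y) j k' p.1 p.2 g f|
          * Real.exp (σV / ((Lc ^ k : ℕ) : ℝ) * (l1 (p.1 - ((Lc ^ k : ℕ) : ℤ) • y) + l1 (p.2 - ((Lc ^ k : ℕ) : ℤ) • y))) ≤ mP j k' :=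
    fun ρ y j k' hjk => mass_rate_mono hrateP (hPs k hk ρ y j k' hjk) (hPm k hk ρ y j k' hjk)
  rw [Vroad_of_neZero]
  exact road_jet_mass_at_flat (Lc ^ k) hrk (S := S (Lc ^ k)) (rate_window hσV0 hσVκ (Lc ^ k)).1 (rate_window hσV0 hσVκ (Lc ^ k)).2
    (fun κ u => (hlit κ u).1) (fun κ u => (hlit κ u).2) (hSmm k hk) (hTs k hk) (hTm k hk)
    (fun ρ y j k' hjk => (hpk ρ y j k' hjk).1) (fun ρ y j k' hjk => (hpk ρ y j k' hjk).2) ρ y j k'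

end Letters

end Summit.QuantumFields.BalabanUV.Beta.D1BFx.PackedRoadRowsMassFlat

end
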